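import Summits.HodgeConjecture.HodgeConjecture.Theorems.Q8SymplecticPowersRegularOfFamilyOneFibre
import Summits.HodgeConjecture.HodgeConjecture.Theorems.Q8SymplecticPowersRegularOfDesingularization
import Literature.AlgebraicGeometry.HodgeTheory.QuaternionicQuarticFamilyHolds
import HarnessLib

/-!
# Route `Q8SymplecticPowers`, crux K1Q (stmt-HodgeConjecture-24190), line `mechanism-v2`: stub S1 `stub_regularVeryGeneralQ`
# FROM A ZARISKI-DENSE SET OF MEMBERS WITH `b₁ = 0` (deformation invariance of `b₁` along the Kollár-free family `QFamily`)

Helper file (`--supports stmt-HodgeConjecture-24190 --as helper`; nothing here closes an item). Sorry-free; axioms standard; no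
definition; no named fact.

The reduction (D) of `…RegularOfDesingularization` (this seat) asks for the vanishing of `b₁` of the desingularisations of `𝒱_a` for
`a` in a Zariski-OPEN set. This file weakens the hypothesis to a Zariski-DENSE set of parameters (Betti currency `b₁ = 0`; the sibling
`…RegularOfDenseRegularMembers` states the same with the irregularity `h^{0,1} = 0`), using deformation invariance: the tree's UNCONDITIONAL smooth projective family
`Q8Family.qFamily_holds e : QFamily e` (prover-Bx ∕ 19716-p2: projective Hironaka on the generic fibre + spreading out; no Kollár binder,
no deck pair) has path-connected base `W(ℂ)` (a non-empty open of `𝔸^{CIdx e}`), so `b₁` is the same on all its fibres (Ehresmann,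
inside `…RegularOfFamilyOneFibre.stub_regularVeryGeneralQ_of_exists_regularFibre`); a dense set of regular parameters meets `W(ℂ)`
(`Q8SymplecticPowersGenericityPolynomials.exists_set_exists_point_iff`: `W(ℂ) ⊇ D(F)(ℂ)` for some `F ≠ 0`), and the fibre there is
birational to `𝒱_a` (the `QFamily` clause with `…RegularOfDesingularization.exists_desingularization_fiberSch`), hence has `b₁ = 0`
(`finrank_bettiCohomology_one_eq_of_birationalOver`).

* `stub_regularVeryGeneralQ_of_dense_bettiRegularMembers` — S1 VERBATIM from

> **(Z_b)** for every even `e ≥ 4` and every `0 ≠ g ∈ ℂ[a]` there is a coefficient vector `a` with `g(a) ≠ 0`, `G_e(a) ≠ 0` and a smooth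
> projective surface `X₀` birational over `ℂ` to `𝒱_a = fiberSch e (eval a)` with `b₁(X₀) = dim_ℚ H¹(X₀(ℂ); ℚ) = 0`

(«the members with `b₁ = 0` are Zariski dense» — implied by (D), and by Naie 2007 Thm. 3.1 at any explicit dense set of parameters).

Honest scope: a reduction; S1, K1Q, HC are NOT proved here.
-/

set_option linter.dupNamespace false

noncomputable section

open CategoryTheory AlgebraicGeometry
open Literature.AlgebraicGeometry Literature.AlgebraicGeometry.Motives Literature.AlgebraicGeometry.HodgeTheory
open Literature.AlgebraicGeometry.HodgeTheory.BettiUniverse Literature.AlgebraicGeometry.HodgeTheory.Q8Family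

namespace Summit.HodgeConjecture.HodgeConjecture.Theorems.Q8SymplecticPowersRegularOfDenseBettiRegularMembers

/-- **S1 from a Zariski-dense set of members with `b₁ = 0`.** If for every even `e ≥ 4` and every non-zero coefficient polynomial `g`
some parameter `a` with `g(a) ≠ 0`, `G_e(a) ≠ 0` carries a smooth projective surface birational over `ℂ` to `𝒱_a` with `b₁ = 0`, then the registered statement of S1 holds VERBATIM (module docstring: deformation invariance of `b₁` along the Kollár-free
family `qFamily_holds`, whose base meets every `D(g)`). [cite: VoisinHodgeI2002, §9.1.1 Thm. 9.3 and §6.1.3 Cor. 6.13]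
[cite: Hartshorne1977, II Ex. 2.7 and V Remark 5.6.1] -/
theorem stub_regularVeryGeneralQ_of_dense_bettiRegularMembers
    (HZ : ∀ ⦃e : ℕ⦄, Even e → 4 ≤ e → ∀ g : ParamRing e, g ≠ 0 → ∃ a : CIdx e → ℂ, MvPolynomial.eval a g ≠ 0 ∧
      MvPolynomial.eval a (genericityElem e) ≠ 0 ∧ ∃ (X₀ : SchemeOver ℂ) (_ : IsSmoothProjective 2 X₀),
        AlgebraicGeometry.Scheme.BirationalOver X₀.hom (fiberSch e (MvPolynomial.eval a)).hom ∧
          Module.finrank ℚ (bettiCohomology X₀ 1) = 0) :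
open Literature.AlgebraicGeometry.Motives Literature.AlgebraicGeometry.HodgeTheory Literature.AlgebraicGeometry.HodgeTheory.BettiUniverse CategoryTheory.Limits in ∀ ⦃e : ℕ⦄, Even e → 4 ≤ e → ∃ G : ℕ → MvPolynomial ({d : Fin 3 →₀ ℕ // d.degree = 1} ⊕ {d : Fin 3 →₀ ℕ // d.degree = e - 1}) ℂ, (∀ i, ∃ c ψ : MvPolynomial (Fin 3) ℂ, c.IsHomogeneous 1 ∧ ψ.IsHomogeneous (e - 1) ∧ MvPolynomial.rename (Equiv.swap (0 : Fin 3) 1) ψ = ψ ∧ MvPolynomial.eval (Sum.elim (fun d => c.coeff d.1) (fun d => ψ.coeff d.1)) (G i) ≠ 0) ∧ ∀ c ψ : MvPolynomial (Fin 3) ℂ, c.IsHomogeneous 1 → ψ.IsHomogeneous (e - 1) → MvPolynomial.rename (Equiv.swap (0 : Fin 3) 1) ψ = ψ → (∀ i, MvPolynomial.eval (Sum.elim (fun d => c.coeff d.1) (fun d => ψ.coeff d.1)) (G i) ≠ 0) → ∀ ⦃V X : SchemeOver ℂ⦄ (hX : IsSmoothProjective 2 X), IsHypersurfaceCutOutBy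 3 (MvPolynomial.X (Fin.last 3) ^ 4 * MvPolynomial.X (Fin.castSucc 2) ^ (2 * e) - MvPolynomial.rename Fin.castSucc (c * MvPolynomial.rename (Equiv.swap (0 : Fin 3) 1) c ^ 3 * ((MvPolynomial.X 0 - MvPolynomial.X 1) * ψ) ^ 2)) V → AlgebraicGeometry.Scheme.BirationalOver X.hom V.hom → Module.finrank ℚ (bettiCohomology X 1) = 0 := by
  refine Q8SymplecticPowersRegularOfFamilyOneFibre.stub_regularVeryGeneralQ_of_exists_regularFibre fun e he h4 => ?_
  have he2 : 2 ≤ e := le_trans (by norm_num) h4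
  -- the Kollár-free smooth projective family of quartic models
  obtain ⟨W, 𝒳, π, hne, hπ, -, hqpW, hsm, hbir⟩ := qFamily_holds e he2
  -- a non-zero `F` with `D(F)(ℂ) ⊆ W(ℂ)`
  obtain ⟨S₀, hS₀⟩ := Q8SymplecticPowersGenericityPolynomials.exists_set_exists_point_iff W
  have hF₀ : ∃ F ∈ S₀, F ≠ 0 := by
    obtain ⟨t⟩ := hne
    have h := (hS₀ (coeffs W t)).1 ⟨t, rfl⟩
    by_contra h'
    push Not at h'
    exact h fun F hFS => by rw [h' F hFS, map_zero]
  obtain ⟨F, hFS, hF0⟩ := hF₀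
  -- a regular member inside `D(F) ⊆ W`
  obtain ⟨a, hFa, hGa, X₀, hX₀, hbir₀, hq⟩ := HZ he h4 F hF0
  obtain ⟨t₀, ht₀⟩ : ∃ t : ComplexPoints (base W), coeffs W t = a :=
    (hS₀ a).2 fun hall => hFa (hall F hFS)
  refine ⟨W, 𝒳, π, 1, one_ne_zero, hne, hπ, hqpW, hsm, fun t _ V hV => hbir t hV, t₀, ?_⟩
  -- `X_{t₀} ~bir 𝒱_a ~bir X₀`, and `b₁(X₀) = 0`
  have hcut := (Q8SymplecticPowersRegularOfDesingularization.exists_desingularization_fiberSch he2 a hGa).1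
  rw [← ht₀] at hcut
  have h1 : AlgebraicGeometry.Scheme.BirationalOver (fiberOver π t₀).hom (fiberSch e (MvPolynomial.eval (coeffs W t₀))).hom :=
    hbir t₀ hcut
  rw [ht₀] at h1
  rw [finrank_bettiCohomology_one_eq_of_birationalOver (hπ.isSmoothProjective t₀) hX₀ (h1.trans hbir₀.symm)]
  exact hq

end Summit.HodgeConjecture.HodgeConjecture.Theorems.Q8SymplecticPowersRegularOfDenseBettiRegularMembers

end
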